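import Summits.KontsevichZagierPeriods.Zeta5Search.DualSeriesDecompositionNine
import Summits.KontsevichZagierPeriods.Zeta5Search.DualSeriesContiguity
import HarnessLib

/-!
# `F̃₉(b)`: one-slot CONTIGUITY on the integer box (cell `pub-zeta5`; fam-vwp's mathematics, filed by PROVER 3)

HONEST FRAMING: systematic search; no irrationality claim unless certified.

This is the contiguity half of the `k = 9` port staged by the family seat `fam-vwp`
(`HOME/lean/fam-vwp/DualSeriesDecompositionNine.lean`, sha256 `12cfe932…`, lines 340–463, VERBATIM apart from the
import/namespace framing, two `F̃₇ ↦ F̃₉` docstring typos, and the reuse of `DualSeries.pochPoly_zero_succ` /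
`pochPoly_succ_left` from `DualSeriesContiguity.lean` instead of local copies — gate dedup), split off because the decomposition half is the
tree file `DualSeriesDecompositionNine.lean` (same namespace `DualSeriesNine`, same declaration names; the 400-line
rule). Port of the typer's `DualSeriesContiguity.lean` (`k = 7`, Lemma 1 of the wedge dictionary):

* `numPoly_update` — raising `b_{i+1}` by one multiplies `numPoly b` by `(X + b_{i+1})(X + b₀ − b_{i+1})`;
* `inBox_update`, `sum_update`, `term_update` — bookkeeping; termwise
  `term (b + e_{i+1}) μ = (μ + 1 + b_{i+1})(μ + 1 + b₀ − b_{i+1}) · term b μ`;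
* **`vwpDual_nine_contiguity`** (and the `Icc 1 9`-indexed `vwpDual_nine_contiguity'`): for integer `b` with
  `0 ≤ b₀`, `0 ≤ b_j ≤ b₀`, `Σ_j b_j ≤ 4b₀ + 1`,
  `F̃₉(b + e_i) − F̃₉(b + e_k) = (b_i − b_k)(b₀ − b_i − b_k) · F̃₉(b)`;
* `vwpDual_nine_mem'` — the decomposition in fam-vwp's shape `F̃₉(b) = a₀ + a₃ζ(3) + a₅ζ(5) + a₇ζ(7)` (bridge from
  `vwpDual_nine_mem`), the existence statement behind the VWP₉ family of `families/vwp/FAMILY.md` (contiguous 3×3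
  minors of `(a₀,a₃,a₅,a₇)` isolate `ζ(5)`).
Everything is PROVED (0 sorry); no arithmetic / denominator statement is claimed.
-/

noncomputable section

open Finset Polynomial

namespace Summit.KontsevichZagierPeriods.Zeta5Search.DualSeriesNine

open Literature.NumberTheory.Irrationality.BrownZudilin2022 (vwpDual vwpDual_eq_tsum)
open Literature.NumberTheory.Irrationality.CressonFischlerRivoal2008 (poch)
open Literature.NumberTheory.Transcendental (zetaValue)
open Literature.NumberTheory.Transcendental.BallRivoal (pochPoly eval_pochPoly poch_reflect)
open Summit.KontsevichZagierPeriods.Zeta5Search.DualSeries (pochPoly_zero_succ pochPoly_succ_left)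

/-- DECOMPOSITION in fam-vwp's shape (Zudilin's Lemma 19 for `r = 1`, `q = 9`, as a theorem on the integer box):
on the box with `Σ_j b_j ≤ 4b₀ + 2`, `F̃₉(b) = a₀ + a₃ζ(3) + a₅ζ(5) + a₇ζ(7)` for some rationals, and the series
(34) converges to it (bridge from `vwpDual_nine_mem`). -/
theorem vwpDual_nine_mem' (b : ℕ → ℤ) (hb : InBox b) (hsum : ∑ j ∈ range 9, b (j + 1) ≤ 4 * b 0 + 2) :
    ∃ a₀ a₃ a₅ a₇ : ℚ,
      HasSum (term b) ((a₀ : ℝ) + a₃ * zetaValue 3 + a₅ * zetaValue 5 + a₇ * zetaValue 7) ∧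
      vwpDual 9 b = a₀ + a₃ * zetaValue 3 + a₅ * zetaValue 5 + a₇ * zetaValue 7 := by
  obtain ⟨u, w, x, v, h1, h2⟩ := vwpDual_nine_mem b hb hsum
  have e : (u : ℝ) * zetaValue 7 + w * zetaValue 5 + x * zetaValue 3 - v =
      ((-v : ℚ) : ℝ) + x * zetaValue 3 + w * zetaValue 5 + u * zetaValue 7 := by
    push_cast
    ring
  exact ⟨-v, x, w, u, by rw [← e]; exact h1, by rw [h2, e]⟩

/-! ### Contiguity in one slot (`k = 9`; port of `DualSeriesContiguity.lean`) -/

/-- Raising `b_{i+1}` by one multiplies the numerator polynomial by `(X + b_{i+1})(X + b₀ − b_{i+1})`. -/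
theorem numPoly_update (b : ℕ → ℤ) {i : ℕ} (hi : i ∈ range 9) (hbi : 0 ≤ b (i + 1)) :
    numPoly (Function.update b (i + 1) (b (i + 1) + 1)) =
      numPoly b * ((X + C (b (i + 1) : ℚ)) * (X + C ((b 0 - b (i + 1) : ℤ) : ℚ))) := by
  have h0 : Function.update b (i + 1) (b (i + 1) + 1) 0 = b 0 := Function.update_of_ne (by omega) _ _
  have hn : (b (i + 1) + 1).toNat = (b (i + 1)).toNat + 1 := by omega
  have hcast : (((b (i + 1)).toNat : ℕ) : ℚ) = (b (i + 1) : ℚ) := by exact_mod_cast Int.toNat_of_nonneg hbi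
  unfold numPoly
  rw [h0, ← mul_prod_erase (range 9) _ hi, ← mul_prod_erase (range 9) (fun j => pochPoly 0 (b (j + 1)).toNat *
      pochPoly ((b 0 - b (j + 1) + 1 : ℤ) : ℚ) (b (j + 1)).toNat) hi]
  have hrest : ∏ j ∈ (range 9).erase i,
      pochPoly 0 (Function.update b (i + 1) (b (i + 1) + 1) (j + 1)).toNat *
        pochPoly ((b 0 - Function.update b (i + 1) (b (i + 1) + 1) (j + 1) + 1 : ℤ) : ℚ)
          (Function.update b (i + 1) (b (i + 1) + 1) (j + 1)).toNat =
      ∏ j ∈ (range 9).erase i, (pochPoly 0 (b (j + 1)).toNat *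
        pochPoly ((b 0 - b (j + 1) + 1 : ℤ) : ℚ) (b (j + 1)).toNat) := by
    refine prod_congr rfl fun j hj => ?_
    have hne : j + 1 ≠ i + 1 := by have := (mem_erase.1 hj).1; omega
    rw [Function.update_of_ne hne]
  rw [hrest, Function.update_self, hn, pochPoly_zero_succ, pochPoly_succ_left, hcast]
  have e1 : ((b 0 - (b (i + 1) + 1) + 1 : ℤ) : ℚ) = ((b 0 - b (i + 1) : ℤ) : ℚ) := by push_cast; ring
  have e2 : ((b 0 - (b (i + 1) + 1) + 1 : ℤ) : ℚ) + 1 = ((b 0 - b (i + 1) + 1 : ℤ) : ℚ) := by push_cast; ring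
  rw [e2, e1]
  ring

/-- The box is stable under `b_{i+1} ↦ b_{i+1} + 1` as long as `b_{i+1} ≤ b₀`. -/
theorem inBox_update (b : ℕ → ℤ) (hb : InBox b) {i : ℕ} (hi : i ∈ range 9) (hbi : b (i + 1) ≤ b 0) :
    InBox (Function.update b (i + 1) (b (i + 1) + 1)) := by
  obtain ⟨h0, hj⟩ := hb
  refine ⟨by rw [Function.update_of_ne (by omega)]; exact h0, fun j hj' => ?_⟩
  rw [Function.update_of_ne (show (0 : ℕ) ≠ i + 1 by omega)]
  by_cases hji : j = i
  · subst hji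
    rw [Function.update_self]
    have := (hj j hi).1
    exact ⟨by omega, by omega⟩
  · rw [Function.update_of_ne (show j + 1 ≠ i + 1 by omega)]
    exact hj j hj'

/-- The parameter sum goes up by one under `b_{i+1} ↦ b_{i+1} + 1`. -/
theorem sum_update (b : ℕ → ℤ) {i : ℕ} (hi : i ∈ range 9) :
    ∑ j ∈ range 9, Function.update b (i + 1) (b (i + 1) + 1) (j + 1) = (∑ j ∈ range 9, b (j + 1)) + 1 := by
  rw [← add_sum_erase (range 9) _ hi, ← add_sum_erase (range 9) (fun j => b (j + 1)) hi, Function.update_self]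
  have hrest : ∑ j ∈ (range 9).erase i, Function.update b (i + 1) (b (i + 1) + 1) (j + 1) =
      ∑ j ∈ (range 9).erase i, b (j + 1) := by
    refine sum_congr rfl fun j hj => ?_
    have hne : j + 1 ≠ i + 1 := by have := (mem_erase.1 hj).1; omega
    rw [Function.update_of_ne hne]
  rw [hrest]
  ring

/-- LEMMA 1, termwise: `term (b + e_{i+1}) μ = (μ + 1 + b_{i+1})(μ + 1 + b₀ − b_{i+1}) · term b μ`. -/
theorem term_update (b : ℕ → ℤ) (hb : InBox b) {i : ℕ} (hi : i ∈ range 9) (hbi : b (i + 1) ≤ b 0) (μ : ℕ) :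
    term (Function.update b (i + 1) (b (i + 1) + 1)) μ =
      (((μ : ℝ) + 1 + b (i + 1)) * ((μ : ℝ) + 1 + (b 0 - b (i + 1)))) * term b μ := by
  have h0 : Function.update b (i + 1) (b (i + 1) + 1) 0 = b 0 := Function.update_of_ne (by omega) _ _
  rw [term_eq _ (inBox_update b hb hi hbi), term_eq _ hb, h0, numPoly_update b hi (hb.2 i hi).1, map_mul,
    map_mul, map_add, map_add, aeval_X, aeval_C, aeval_C, eq_ratCast, eq_ratCast]
  push_cast
  ring

/-- CONTIGUITY (`k = 9`), PROVED: for integer `b` with `0 ≤ b₀`,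
`0 ≤ b_j ≤ b₀` (`j = 1,…,9`) and `Σ_j b_j ≤ 4b₀ + 1`,
`F̃₉(b + e_i) − F̃₉(b + e_k) = (b_i − b_k)(b₀ − b_i − b_k) · F̃₉(b)` (indices written `i+1`, `k+1` with
`i, k < 9`). The `μ`-dependence cancels termwise (`term_update`); the two shifted series converge by
`summable_term`. -/
theorem vwpDual_nine_contiguity (b : ℕ → ℤ) (h0 : 0 ≤ b 0)
    (hb : ∀ j ∈ range 9, 0 ≤ b (j + 1) ∧ b (j + 1) ≤ b 0) (hsum : ∑ j ∈ range 9, b (j + 1) ≤ 4 * b 0 + 1)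
    {i k : ℕ} (hi : i ∈ range 9) (hk : k ∈ range 9) :
    vwpDual 9 (Function.update b (i + 1) (b (i + 1) + 1)) -
        vwpDual 9 (Function.update b (k + 1) (b (k + 1) + 1)) =
      (((b (i + 1) - b (k + 1)) * (b 0 - b (i + 1) - b (k + 1)) : ℤ) : ℝ) * vwpDual 9 b := by
  have hbox : InBox b := ⟨h0, fun j hj => ⟨(hb j hj).1, by linarith [(hb j hj).2]⟩⟩
  have hS : ∀ {l : ℕ}, l ∈ range 9 → Summable (term (Function.update b (l + 1) (b (l + 1) + 1))) :=
    fun {l} hl => summable_term _ (inBox_update b hbox hl (hb l hl).2) (by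
      rw [sum_update b hl, Function.update_of_ne (show (0 : ℕ) ≠ l + 1 by omega)]
      linarith)
  rw [vwpDual_nine_eq_tsum, vwpDual_nine_eq_tsum, vwpDual_nine_eq_tsum, ← (hS hi).tsum_sub (hS hk),
    ← tsum_mul_left]
  congr 1
  funext μ
  rw [term_update b hbox hi (hb i hi).2 μ, term_update b hbox hk (hb k hk).2 μ]
  push_cast
  ring

/-- The same with indices `j, k ∈ [1, 9]` and the shift written `b + e_j = Function.update b j (b j + 1)`. -/
theorem vwpDual_nine_contiguity' (b : ℕ → ℤ) (h0 : 0 ≤ b 0)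
    (hb : ∀ j ∈ Icc 1 9, 0 ≤ b j ∧ b j ≤ b 0) (hsum : ∑ j ∈ Icc 1 9, b j ≤ 4 * b 0 + 1)
    {j k : ℕ} (hj : j ∈ Icc 1 9) (hk : k ∈ Icc 1 9) :
    vwpDual 9 (Function.update b j (b j + 1)) - vwpDual 9 (Function.update b k (b k + 1)) =
      (((b j - b k) * (b 0 - b j - b k)) : ℤ) * vwpDual 9 b := by
  have hIcc : ∑ j ∈ Icc 1 9, b j = ∑ j ∈ range 9, b (j + 1) := by
    rw [range_eq_Ico, sum_Ico_add' b 0 9 1]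
    rfl
  obtain ⟨i, rfl⟩ : ∃ i, j = i + 1 := ⟨j - 1, by have := (mem_Icc.1 hj).1; omega⟩
  obtain ⟨l, rfl⟩ : ∃ l, k = l + 1 := ⟨k - 1, by have := (mem_Icc.1 hk).1; omega⟩
  have hi : i ∈ range 9 := by have := (mem_Icc.1 hj).2; exact mem_range.2 (by omega)
  have hl : l ∈ range 9 := by have := (mem_Icc.1 hk).2; exact mem_range.2 (by omega)
  have hb' : ∀ j ∈ range 9, 0 ≤ b (j + 1) ∧ b (j + 1) ≤ b 0 := fun j hj' =>
    hb (j + 1) (by have := mem_range.1 hj'; exact mem_Icc.2 ⟨by omega, by omega⟩)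
  exact vwpDual_nine_contiguity b h0 hb' (by rw [← hIcc]; exact hsum) hi hl

end Summit.KontsevichZagierPeriods.Zeta5Search.DualSeriesNine
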